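import Summits.ABC.ABC.Theses.IsogenyGlueCongruence
import Summits.ABC.ABC.Theses.RibetTakahashiSplit
import Summits.ABC.ABC.Theorems.IsogenyGlueCongruenceMazurKenkuBoundGlue
import Literature.NumberTheory.EllipticCurves.ManinConstantFiniteHeightPrimesProofs
import Literature.NumberTheory.EllipticCurves.NeronIsogenyScalingHoldsProofs
import Literature.NumberTheory.EllipticCurves.PastenHeightBoundsLemma68Proofs
import Literature.NumberTheory.EllipticCurves.AdditiveReductionSemistableModelProofs
import HarnessLib

/-!
# Route `IsogenyGlueCongruence`, crux `MazurKenkuBound` (stmt-ABC-15125): the SEMISTABLE crux follows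
# from the Mazur–Kenku radius ALONE (the Edixhoven input is now a theorem for semistable curves)

Lead c17 of the crux, 2026-08-16. The crux `MazurKenkuBound` is the join of its two sibling cruxes
stmt-ABC-15193 (`MazurKenkuRadius`) and stmt-ABC-15990 (`EdixhovenIntegrality` = the named fact
`edixhoven_int_of_neronLattice_eq_smul_periodLattice`, Edixhoven 1991 Prop. 2, for ALL globally
minimal `W'`). The finite-height route to that fact reached, on 2026-08-16, every curve `W'` whose
reduction at `2` and at `3` is not additive
(`Literature.NumberTheory.EllipticCurves.int_of_neronLattice_eq_smul_periodLattice_of_not_additive_two_three`,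
file `ManinConstantFiniteHeightPrimesProofs`; the `p = 2` inputs are this lead's
`FormalGroupFrobeniusTypeAllPrimesProofs` / `HondaStrongIsomorphismAllPrimesProofs`). Every consumer
of the crux in this route is SEMISTABLE (K-line `DegreePrimeCongruence`, U-line
`SemistableHeightPolyBound`). This file proves, sorry-free and WITHOUT any Edixhoven hypothesis:

* `hInt_of_isSemistableAt_two_three` — **Néron integrality for data of curves semistable at `2` and
  `3`**: for a globally minimal elliptic `W'/ℚ` with good or multiplicative reduction at the places
  over `2` and `3`, every rational `q` with `qΛ_f ⊆ Λ_{W'}` (for a parametrisation datum `D'` of `W'`,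
  `f = D'.f`) is an integer. Proof: the optimal pivot `hInt_of_pivot` made pointwise — the strong Weil
  curve's minimal model `W₀` (`exists_isGloballyMinimal_latticeEq_rat`, `Λ_{W₀} = q₀Λ_f`) is
  `ℚ`-isogenous to `W'` (`isIsogenous_of_forall_mul_mem_lattice` along `z ↦ (q/q₀)z`), hence also not
  additive at `2`, `3` (good and multiplicative reduction are isogeny invariants:
  `IsIsogenous.hasGoodReductionAt_iff_of_isIsogenous`,
  `Isogeny.hasMultiplicativeReductionAt_of_hasMultiplicativeReductionAt`, with
  `hasAdditiveReductionAt_of_dvd_of_dvd`), so `q₀ ∈ ℤ` by the finite-height theorem, and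
  `q/q₀ ∈ ℤ` by the DISCHARGED Néron scaling `integral_neronScaling_of_isGloballyMinimal_holds`.
* `exists_int_ker_le_163_of_radius_of_isSemistableAt_two_three` — the Mazur–Kenku bound in
  Néron-lattice form for such `W'`, from the RADIUS (`MazurKenkuRadius`, stmt-ABC-15193) alone
  (`pastenShimura_minimalDegree_le_163_mul_of_radius` made pointwise).
* `modularDegree_le_163_mul_of_radius_of_isSemistableAt_two_three` and
  `mazurKenkuBound_isSemistable_of_radius` — **the crux statement for `W'` semistable at `2`, `3`
  (in particular for semistable `W'`) from `MazurKenkuRadius` alone**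
  (`PastenShimura2024_minimalDegree_le_163_mul_of` made pointwise).

NOTE FOR PLANNERS (D-0014): a re-cut of the crux to `W'` semistable (or semistable at `2` and `3`)
is closed by `mazurKenkuBound_isSemistable_of_radius h` the day stmt-ABC-15193 closes, and no longer
needs stmt-ABC-15990 (whose residue is exactly the additive primes `2`, `3`).
-/

-- `Summit.<Summit>.<Problem>` is the mandated summit-side namespace (CONVENTIONS §2); for the
-- single-conjunct summit `ABC` the two coincide, so the duplicate `ABC.ABC` is deliberate.
set_option linter.dupNamespace false

noncomputable section

open scoped MatrixGroups ModularForm NumberField Classical UpperHalfPlane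

open CongruenceSubgroup
open WeierstrassCurve
open IsDedekindDomain
open Rat.HeightOneSpectrum
open Literature.NumberTheory.EllipticCurves
open Literature.NumberTheory.EllipticCurves.ModularForms

namespace Summit.ABC.ABC.Theorems

/-! ### Néron integrality for data of curves semistable at `2` and `3` (unconditional) -/

/-- **Néron integrality `hInt` for curves semistable at `2` and `3`, unconditionally.** For a
globally minimal elliptic `W'/ℚ` with good or multiplicative reduction at the places over `2` and
`3`, a parametrisation datum `D'` of `W'` and `q ∈ ℚ` with `qΛ_{D'.f} ⊆ Λ_{W'}`: `q ∈ ℤ`. The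
optimal pivot made pointwise: `W₀` the strong Weil curve's minimal model (`Λ_{W₀} = q₀Λ_f`),
`ℚ`-isogenous to `W'` along `z ↦ (q/q₀)z`, hence not additive at `2`, `3`; `q₀ ∈ ℤ` by the
finite-height theorem `int_of_neronLattice_eq_smul_periodLattice_of_not_additive_two_three`, and
`q/q₀ ∈ ℤ` by the discharged Néron scaling. [cite: EdixhovenManin1991, Prop. 2]
[cite: SilvermanAEC2009, Cor. VII.7.2] [cite: PastenShimura2024, §3 p. 13] -/
theorem hInt_of_isSemistableAt_two_three {N : ℕ} [NeZero N] {W' : WeierstrassCurve ℚ}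
    [W'.IsElliptic] [W'.IsGloballyMinimal]
    (hss : ∀ v : HeightOneSpectrum (𝓞 ℚ), ((primesEquiv v : ℕ) = 2 ∨ (primesEquiv v : ℕ) = 3) →
      W'.IsSemistableAt v)
    (D' : ModularParametrizationData W' N) (q : ℚ)
    (hq : ∀ z ∈ periodLattice D'.f, (q : ℂ) * z ∈ D'.L.lattice) : ∃ k : ℤ, (k : ℚ) = q := by
  by_cases hq0 : q = 0
  · exact ⟨0, by rw [hq0, Int.cast_zero]⟩
  obtain ⟨W₀, hW₀, hW₀', L₀, q₀, hf₀, hL₀, hq₀0, hq₀, hq₀'⟩ :=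
    D'.exists_isGloballyMinimal_latticeEq_rat
  haveI := hW₀
  haveI := hW₀'
  have hq₀c : (q₀ : ℂ) ≠ 0 := by exact_mod_cast hq₀0
  -- `α = q / q₀` maps `Λ_{W₀} = q₀ Λ_f` into `Λ_{W'}`
  have hα : ∀ z ∈ L₀.lattice, ((q / q₀ : ℚ) : ℂ) * z ∈ D'.L.lattice := by
    intro z hz
    obtain ⟨w, hw, hzw⟩ := hq₀' z hz
    have key : ((q / q₀ : ℚ) : ℂ) * z = (q : ℂ) * w := by
      rw [hzw, Rat.cast_div]
      field_simp
    rw [key]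
    exact hq w hw
  have hα0 : q / q₀ ≠ 0 := div_ne_zero hq0 hq₀0
  -- `W₀ ~ W'` over `ℚ`
  have hiso : IsIsogenous W₀ W' :=
    isIsogenous_of_forall_mul_mem_lattice hL₀.1 hL₀.2 D'.isNeronLattice.1 D'.isNeronLattice.2 hα0 hα
  -- hence `W₀` is not additive at `2` and `3`
  have hna : ∀ p : ℕ, p.Prime → (p = 2 ∨ p = 3) →
      ¬ ((p : ℤ) ∣ minimalDiscriminantInt W₀ ∧ (p : ℤ) ∣ (integralModelInt W₀).c₄) := by
    rintro p hp h23 ⟨hΔ, hc₄⟩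
    set v : HeightOneSpectrum (𝓞 ℚ) := primesEquiv.symm ⟨p, hp⟩ with hv
    have hvp : (primesEquiv v : ℕ) = p := by rw [hv, Equiv.apply_symm_apply]
    have hadd : W₀.HasAdditiveReductionAt v :=
      W₀.hasAdditiveReductionAt_of_dvd_of_dvd v (by rw [hvp]; exact hΔ) (by rw [hvp]; exact hc₄)
    rcases hss v (by rw [hvp]; exact h23) with hgood | hmult
    · exact hadd.not_hasGoodReductionAt ((hiso.hasGoodReductionAt_iff_of_isIsogenous v).mpr hgood)
    · obtain ⟨ψ⟩ := IsIsogenous.symm_of_charZero hiso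
      exact hadd.not_hasMultiplicativeReductionAt
        (ψ.hasMultiplicativeReductionAt_of_hasMultiplicativeReductionAt hmult)
  -- (I-opt), now a theorem: the Manin constant `q₀` of the strong Weil curve is an integer
  obtain ⟨k₀, hk₀⟩ := int_of_neronLattice_eq_smul_periodLattice_of_not_additive_two_three hf₀ hL₀ hq₀ hq₀'
    (by exact_mod_cast hna 2 Nat.prime_two (Or.inl rfl))
    (by exact_mod_cast hna 3 Nat.prime_three (Or.inr rfl))
  -- (I-ell), discharged: `α ∈ ℤ`
  obtain ⟨m, hm⟩ := integral_neronScaling_of_isGloballyMinimal_holds W₀ W' L₀ D'.L hL₀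
    D'.isNeronLattice (q / q₀) hα
  refine ⟨m * k₀, ?_⟩
  push_cast
  rw [hm, hk₀]
  field_simp

/-- The same for a SEMISTABLE `W'` (good or multiplicative reduction at every finite place).
[cite: EdixhovenManin1991, Prop. 2] [cite: SilvermanAEC2009, Cor. VII.7.2] -/
theorem hInt_of_isSemistable {N : ℕ} [NeZero N] {W' : WeierstrassCurve ℚ}
    [W'.IsElliptic] [W'.IsGloballyMinimal] (hss : W'.IsSemistable (𝓞 ℚ))
    (D' : ModularParametrizationData W' N) (q : ℚ)
    (hq : ∀ z ∈ periodLattice D'.f, (q : ℂ) * z ∈ D'.L.lattice) : ∃ k : ℤ, (k : ℚ) = q :=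
  hInt_of_isSemistableAt_two_three (fun v _ ↦ hss v) D' q hq

/-! ### The Mazur–Kenku bound in Néron-lattice form, from the radius, for such `W'` -/

/-- **`kΛ_f ⊆ Λ_{W'}` with `#ker(z ↦ kz) ≤ 163` for `W'` semistable at `2`, `3`, from the RADIUS
alone** — `pastenShimura_minimalDegree_le_163_mul_of_radius` made pointwise, with its `hInt` input
supplied by `hInt_of_isSemistableAt_two_three`: the `ℚ`-model `E_f` of `ℂ/Λ_f` is `ℚ`-isogenous to
`W'`, the radius gives `ψ` of degree `≤ 163` between the short models, its rational multiplier `q`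
has `qΛ_f ⊆ Λ_{W'}` and `#ker(z ↦ qz) = deg ψ`, and `q ∈ ℤ`. [cite: PastenShimura2024, §3 p. 13]
[cite: Mazur1978, Thm. 1] [cite: Kenku1982, Thm. 1] -/
theorem exists_int_ker_le_163_of_radius_of_isSemistableAt_two_three
    (hRad : ∀ (W W' : WeierstrassCurve ℚ) [W.IsElliptic] [W'.IsElliptic], IsIsogenous W W' →
      ∃ φ : Isogeny W W', φ.degree ≤ 163)
    {N : ℕ} [NeZero N] {W' : WeierstrassCurve ℚ} [W'.IsElliptic] [W'.IsGloballyMinimal]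
    (hss : ∀ v : HeightOneSpectrum (𝓞 ℚ), ((primesEquiv v : ℕ) = 2 ∨ (primesEquiv v : ℕ) = 3) →
      W'.IsSemistableAt v)
    (D' : ModularParametrizationData W' N) :
    ∃ (k : ℤ) (hk : ∀ z ∈ periodLattice D'.f, (k : ℂ) * z ∈ D'.L.lattice), k ≠ 0 ∧
      Nat.card (mulQuotientMap (periodLattice D'.f) D'.L.lattice.toAddSubgroup (k : ℂ) hk).ker
        ≤ 163 := by
  -- the `ℚ`-model `W₀ = E_f` of `ℂ/Λ_f`, with Néron-type lattice exactly `Λ_f`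
  obtain ⟨W₀, hW₀, -, L₀, hL₀, hΛ⟩ := D'.exists_latticeEq_model
  haveI := hW₀
  have hmem : ∀ z, z ∈ L₀.lattice ↔ z ∈ periodLattice D'.f := fun z ↦ by
    rw [← SetLike.mem_coe, hΛ, SetLike.mem_coe]
  -- `W₀ ~ W'` over `ℚ`, along `z ↦ c' z`
  have hc : (D'.c : ℚ) ≠ 0 := by exact_mod_cast D'.maninConstant_ne_zero_holds
  have hle : ∀ z ∈ L₀.lattice, ((D'.c : ℚ) : ℂ) * z ∈ D'.L.lattice := fun z hz ↦ by
    rw [Rat.cast_intCast]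
    exact D'.smul_periodLattice_le z ((hmem z).mp hz)
  have hiso : IsIsogenous W₀ W' :=
    isIsogenous_of_forall_mul_mem_lattice hL₀.1 hL₀.2 D'.isNeronLattice.1 D'.isNeronLattice.2 hc hle
  -- the short models are `E_{Λ_f}`, `E_{Λ_{E'}}` after base change, and are `ℚ`-isogenous
  set C₀ : VariableChange ℚ := ⟨1, -W₀.b₂ / 12, -W₀.a₁ / 2, W₀.a₁ * W₀.b₂ / 24 - W₀.a₃ / 2⟩
    with hC₀
  set C' : VariableChange ℚ := ⟨1, -W'.b₂ / 12, -W'.a₁ / 2, W'.a₁ * W'.b₂ / 24 - W'.a₃ / 2⟩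
    with hC'
  have hE₀ : (C₀ • W₀).baseChange ℂ = L₀.curve := shortModel_baseChange_eq_curve W₀ hL₀
  have hE' : (C' • W').baseChange ℂ = D'.L.curve :=
    shortModel_baseChange_eq_curve W' D'.isNeronLattice
  have h : IsIsogenous (C₀ • W₀) (C' • W') :=
    (isIsogenous_of_smul W₀ C₀).trans' (hiso.trans' (isIsogenous_smul W' C'))
  -- RADIUS: a `ℚ`-isogeny `ψ` of degree `≤ 163`
  obtain ⟨ψ, h163⟩ := hRad (C₀ • W₀) (C' • W') h
  -- its rational multiplier `q`: `qΛ_f ⊆ Λ_{E'}`, `#ker(z ↦ qz) = deg ψ`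
  obtain ⟨q, hq0, hq, hdegq⟩ :=
    degree_eq_natCard_ker_mulQuotientMap_of_baseChange_eq_curve ψ hE₀ hE'
  have hq' : ∀ z ∈ periodLattice D'.f, (q : ℂ) * z ∈ D'.L.lattice := fun z hz ↦
    hq z ((hmem z).mpr hz)
  -- `q = k ∈ ℤ` — unconditionally, `W'` being semistable at `2` and `3`
  obtain ⟨k, rfl⟩ := hInt_of_isSemistableAt_two_three hss D' q hq'
  have hk : ∀ z ∈ periodLattice D'.f, (k : ℂ) * z ∈ D'.L.lattice := fun z hz ↦ by
    have := hq' z hz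
    rwa [Rat.cast_intCast] at this
  refine ⟨k, hk, by exact_mod_cast hq0, ?_⟩
  have hΛ' : L₀.lattice.toAddSubgroup = periodLattice D'.f :=
    SetLike.coe_injective (by rw [Submodule.coe_toAddSubgroup, hΛ])
  have hcast : ((k : ℚ) : ℂ) = (k : ℂ) := Rat.cast_intCast k
  calc Nat.card (mulQuotientMap (periodLattice D'.f) D'.L.lattice.toAddSubgroup (k : ℂ) hk).ker
      = Nat.card (mulQuotientMap L₀.lattice.toAddSubgroup D'.L.lattice.toAddSubgroup
          ((k : ℚ) : ℂ) hq).ker := by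
        simp only [hcast]
        exact (natCard_ker_mulQuotientMap_congr hΛ' rfl (fun z hz ↦ hk z (hΛ' ▸ hz)) hk).symm
    _ = ψ.degree := hdegq.symm
    _ ≤ 163 := h163

/-! ### The crux statement for `W'` semistable at `2` and `3`, from the radius alone -/

/-- **`deg φ_{D'} ≤ 163 · deg φ_D` for `W'` semistable at `2` and `3`, from the RADIUS alone** —
`PastenShimura2024_minimalDegree_le_163_mul_of` made pointwise: with `δ` the degree of
`Y₀(N) → ℂ/Λ_f`, the datum of `W'` with Manin constant `k`
(`exists_int_ker_le_163_of_radius_of_isSemistableAt_two_three`) has degree `#ker · δ ≤ 163 · δ`,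
`δ ≤ deg φ_D`, and `D'` has minimal degree among the data of `W'`. The optimality hypothesis on
`D` of the crux is not needed (cf. `Negative/StrongForm`). [cite: PastenShimura2024, §3 p. 13]
[cite: Mazur1978, Thm. 1] [cite: Kenku1982, Thm. 1] [cite: EdixhovenManin1991, Prop. 2] -/
theorem modularDegree_le_163_mul_of_radius_of_isSemistableAt_two_three
    (hRad : ∀ (W W' : WeierstrassCurve ℚ) [W.IsElliptic] [W'.IsElliptic], IsIsogenous W W' →
      ∃ φ : Isogeny W W', φ.degree ≤ 163)
    {N : ℕ} [NeZero N] {W W' : WeierstrassCurve ℚ} [W.IsElliptic] [W'.IsElliptic]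
    [W'.IsGloballyMinimal] (D : ModularParametrizationData W N) (D' : ModularParametrizationData W' N)
    (hf : D'.f = D.f) (hmin' : ∀ D'' : ModularParametrizationData W' N, D'.modularDegree ≤ D''.modularDegree)
    (hss : ∀ v : HeightOneSpectrum (𝓞 ℚ), ((primesEquiv v : ℕ) = 2 ∨ (primesEquiv v : ℕ) = 3) →
      W'.IsSemistableAt v) :
    D'.modularDegree ≤ 163 * D.modularDegree := by
  -- the degree `δ` of the Eichler–Shimura map of `f = D'.f = D.f`
  haveI := discreteTopology_periodLattice_of_mul_mem D'.f D'.cast_c_ne_zero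
    D'.smul_periodLattice_le
  obtain ⟨δ, hδ, hfinδ⟩ := exists_degree_eichlerShimuraMap' (N := N) D'.isNewformOf.1.ne_zero
  -- `δ ≤ deg φ_D`
  have hδD : δ ≤ D.modularDegree := D.degree_eichlerShimuraMap_le_modularDegree hf.symm hδ hfinδ
  -- the datum of `W'` with Manin constant `k`, of degree `#ker · δ ≤ 163 · δ`
  obtain ⟨k, hk, hk0, hk163⟩ :=
    exists_int_ker_le_163_of_radius_of_isSemistableAt_two_three hRad hss D'
  obtain ⟨d, hd, hfin⟩ := exists_modularDegree_holds D'.isNewformOf.1.ne_zero (L := D'.L)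
    (c := (k : ℂ)) (Int.cast_ne_zero.mpr hk0) hk
  have he : ∀ x : ℂ, D'.torusEquiv.toEquiv (x : ℂ ⧸ D'.L.lattice.toAddSubgroup) = D'.uniformize x :=
    fun _ ↦ rfl
  have key := (finite_setOf_card_fiberOrbits_ne_iff D'.torusEquiv.toEquiv
    (fun τ : ℍ ↦ (((k : ℂ) * eichlerIntegral D'.f τ : ℂ) : ℂ ⧸ D'.L.lattice.toAddSubgroup)) d).mpr
    hfin
  simp only [he] at key
  let Dk : ModularParametrizationData W' N :=
    { D' with
      c := k
      smul_periodLattice_le := hk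
      deg := d
      deg_pos := hd
      deg_spec := key }
  obtain ⟨hfinK, hdegK⟩ := Dk.modularDegree_eq_card_ker_mul_of_eichlerShimuraMap rfl hδ hfinδ
  have hkerK : Nat.card Dk.isogenyMap.ker ≤ 163 := hk163
  calc D'.modularDegree ≤ Dk.modularDegree := hmin' Dk
    _ = Nat.card Dk.isogenyMap.ker * δ := hdegK
    _ ≤ 163 * δ := Nat.mul_le_mul_right δ hkerK
    _ ≤ 163 * D.modularDegree := Nat.mul_le_mul_left 163 hδD

/-- **The crux `MazurKenkuBound` restricted to `W'` semistable at `2` and `3` follows from the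
sibling crux `MazurKenkuRadius` (stmt-ABC-15193) ALONE** — binder for binder the crux statement
(`Summit.ABC.ABC.Theses.IsogenyGlueCongruence.MazurKenkuBound`) with the one extra hypothesis
`hss`; the Edixhoven input (stmt-ABC-15990) is no longer needed in this regime, its residue being
exactly the additive primes `2`, `3`. [cite: PastenShimura2024, §3 p. 13] [cite: Mazur1978, Thm. 1]
[cite: Kenku1982, Thm. 1] [cite: EdixhovenManin1991, Prop. 2] -/
theorem mazurKenkuBound_isSemistableAt_two_three_of_radius
    (hRad : Summit.ABC.ABC.Theses.RibetTakahashiSplit.MazurKenkuRadius) :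
    ∀ (N : ℕ) [NeZero N] (W W' : WeierstrassCurve ℚ) [W.IsElliptic] [W'.IsElliptic]
      [W'.IsGloballyMinimal] (D : ModularParametrizationData W N)
      (D' : ModularParametrizationData W' N), D'.f = D.f →
      (∀ (W'' : WeierstrassCurve ℚ) [W''.IsElliptic] (D'' : ModularParametrizationData W'' N),
        D''.f = D.f → D.modularDegree ≤ D''.modularDegree) →
      (∀ D'' : ModularParametrizationData W' N, D'.modularDegree ≤ D''.modularDegree) →
      (∀ v : HeightOneSpectrum (𝓞 ℚ), ((primesEquiv v : ℕ) = 2 ∨ (primesEquiv v : ℕ) = 3) →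
        W'.IsSemistableAt v) →
      D'.modularDegree ≤ 163 * D.modularDegree :=
  fun _ _ _ _ _ _ _ D D' hf _ hmin' hss ↦
    modularDegree_le_163_mul_of_radius_of_isSemistableAt_two_three hRad D D' hf hmin' hss

/-- **In particular for SEMISTABLE `W'`** (good or multiplicative reduction at every finite place —
the regime of every consumer of the crux in this route): the crux statement from `MazurKenkuRadius`
alone. [cite: PastenShimura2024, §3 p. 13] [cite: Mazur1978, Thm. 1] [cite: Kenku1982, Thm. 1] -/
theorem mazurKenkuBound_isSemistable_of_radius
    (hRad : Summit.ABC.ABC.Theses.RibetTakahashiSplit.MazurKenkuRadius) :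
    ∀ (N : ℕ) [NeZero N] (W W' : WeierstrassCurve ℚ) [W.IsElliptic] [W'.IsElliptic]
      [W'.IsGloballyMinimal] (D : ModularParametrizationData W N)
      (D' : ModularParametrizationData W' N), D'.f = D.f →
      (∀ (W'' : WeierstrassCurve ℚ) [W''.IsElliptic] (D'' : ModularParametrizationData W'' N),
        D''.f = D.f → D.modularDegree ≤ D''.modularDegree) →
      (∀ D'' : ModularParametrizationData W' N, D'.modularDegree ≤ D''.modularDegree) →
      W'.IsSemistable (𝓞 ℚ) → D'.modularDegree ≤ 163 * D.modularDegree :=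
  fun _ _ _ _ _ _ _ D D' hf _ hmin' hss ↦
    modularDegree_le_163_mul_of_radius_of_isSemistableAt_two_three hRad D D' hf hmin' fun v _ ↦ hss v

end Summit.ABC.ABC.Theorems

end
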